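import Literature.MathematicalPhysics.QuantumFieldTheory.BalabanImbrieJaffe1984to88.BIJ88EndChainFluct309

/-!
# `BalabanImbrieJaffe1984to88.BIJ88Ineq5144EndChainDecay` — T. Bałaban, J. Imbrie, A. Jaffe, *Effective action and cluster properties of the
abelian Higgs model*, Commun. Math. Phys. **114** (1988) 257–315 [BalabanImbrieJaffe1988], Sect. 5.14 (5.14.4) p. 309 [PDF 53] with Sect. 5.13
p. 305–307 [PDF 49–51] and [Balaban1982Higgs2] (2.28)–(2.29) p. 563: **(5.14.4), LOCATED, ON THE END-DECORATED THREE-CUBE CHAIN FOR A COUPLED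
PRECISION CARRYING THE DECAY LETTER (i) AND THE V-SURPLUS CLAUSE (ii)** — the INSTANCE of the re-scoped flip item of row C2.Eq5.14.3-5.14.4
(r16 ROWS-C2-part2 v2.253: *«(5.14.4) located on |X_β| ≥ 3 for COUPLED Δ carrying (i) a print-kind inter-cube DECAY letter on C_s (p.307) AND (ii) the
located V-surplus clause K_Y e^{2GK₁} ≤ θ^{1+β′·a(Y)}/2»*) on the data class of the kernel witness `BIJ88Ineq5144TripleDecayWitness` (p36 g18: the
same bound is FALSE on this class under every volume-uniform clause on the letters WITHOUT decay).

THE INSTANCE CLASS (witness #3's; «the class» of the ruling): the §5.13 model (sites `α`, cubes `I`, block map, precision `Δ ≻ 0`, `Δ ≥ m·1`, cube-local slot fields and terms,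
`|V_Y| ≤ K_Y ≤ K₁`, `≤ G` slots per cube), SOURCELESS (`ℱ = 0`), and the polymer `X₃ = {a, b, n}`: the cube `□_a` decorated by interaction slots
only (no χ-slot of the region sits in `□_a`), the cubes `□_b`, `□_n` slot-free, and `□_n` — THE FAR END OF THE CHAIN — not coupled to `□_a` by `Δ`
(`a – b – n`).  THE LETTERS DISPLAYED (owner r16 ⟦v2.271⟧ / 07:01Z): **(b)** the pointwise decay of the RESTRICTED inverse
`|((Δ_{1_{Λ′}})_s↾Λ)⁻¹(x,l)| ≤ c₁δ^{d(x,l)}`, `Λ` = the sites OFF the observable's cube `□_a` (the conditioning set), UNIFORM in `s ∈ [0,1]^I`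
supported in `X₃` (constants `c₁, δ` free of `s`; print p. 307: *"chains of covariances C_ω(α) … If the walk ω(α) wanders through more than a few
cubes, we begin to pickup factors e^{−cr(e_k)}"*, `δ` = print's `e^{−cr(e_k)}`, `d(x,l)` the separation of sites in units of the cube side `r(e_k)`);
the geometry letters **W** (sites per cube) and **R** (off-diagonal row sums of `Δ`); the chain's one geometric fact (the `□_n`-side of `□_b` and
`□_n` lie `≥ 1` unit from the `□_a`-side of `□_b` — print's cubes have side `r(e_k)`, so (b) delivers `δ` per crossing of `□_b`, and the
fluctuation is `O(δ²)`: print's count of one small factor per undecorated cube); **(ii)** the located V-surplus clause `K_Y e^{2GK₁} ≤ θ^{1+β′}/2`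
(`a(Y) = 1`); the V-half `e^{2GK₁} − 1 ≤ θ^{2β′}/2` of the two-cube vacuum clause; the engine's form bound `Δ ≥ m·1` (the upper bound is
automatic on a finite lattice); `0 ≤ t ≤ 1`; and the regime clause **`4W³R³c₁²δ² ≤ m·θ^{β′}`** tying `δ` to `θ` (print: `e^{−cr(e_k)}` is smaller than any power
of `e_k^{1/4−α}`).  CONCLUSION: the located (5.14.4)-shape bound

  `|locAct (□∘γ) g₃ (H, X₃)| ≤ θ^{|H| + β′·|X₃ ∖ □(γ(H))|}`      (`ineq5144_locAct_endChain_of_decay`).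

GEOMETRY CLAUSE `hgeo` (same standing as W, R and `a(Y)`; owner r16 08:16Z): `ds x l ≥ 1` whenever `x` is a site of `□_n` or a site of `□_b` coupled
to `□_n`, and `l` is a site of `□_b` coupled to `□_a` — it encodes «the coupling range of `Δ` is small against the cube side `r(e_k)`»: for a
nearest-neighbour `Δ` the two site sets sit on opposite faces of `□_b`, one cube side apart.  This is print's lattice geometry (p. 305: *"Using the
theorem on unit lattice operators in [6], we can invert this operator to yield an exponentially decaying covariance C_s"* — decay in lattice
distance, `δ = e^{−cr(e_k)}` one cube side's worth of it), not an analytic input; `ds` = site separation in units of the cube side (owner: accepted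
and preferred over a cube-distance exponent, which is either false across a shared face or void on the rows the majorant needs).

θ-ACCOUNTING (v1.1; which hypothesis pays which factor of `θ^{|H| + β′·|X₃∖□(γ(H))|}`; the engine gives `|g₃| ≤ 2^{|X₃|−1}·2K₀·M = 8K₀M`):
(D) `H ≠ ∅` — every label sits in `□_a`, `X₃∖□(γ(H)) = {b, n}`, exponent `|H| + 2β′`: clause (ii) gives `K₀ = (θ^{1+β′}/2)^{|H|} ≤ ½θ^{|H|+β′}`,
i.e. `θ^{|H|}` (print's one factor per `V^{(k)}(Y)`-derivative) AND the `θ^{β′}` of the undecorated cube `□_b` directly coupled to `□(Y) = □_a`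
(the located surplus, `a(Y) = 1`); the decay gives `M ≤ θ^{β′}/4` through the regime clause (`M ≤ W·R·(Wc₁δR)²/m`, `δ²` = one `δ` for the response
of `□_n`'s conditional mean to `□_a` and one for that of `□_b`'s `□_n`-face), i.e. the `θ^{β′}` of the far cube `□_n`; `8·½·¼ = 1`.
(V) `H = ∅` — exponent `3β′`: the vacuum clause gives `K₀ = θ^{2β′}/2 ≥ e^{2GK₁} − 1 ≥ |Π_Y e^{−tV_Y} − 1|` (the `θ^{β′}`'s of `□_a` and `□_b`), the
decay gives `□_n`'s `θ^{β′}` as in (D); `8·½·¼ = 1`.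
PRINT'S COUNT (p. 309: *"Each factor V^{(k)}(Y) in Π(d/dt)_{γ_j} produces a factor e^β(L^kε/ε₀)^{1/4−α} in the final estimate"*; p. 307: the walk joining the cubes
picks up `e^{−cr(e_k)}` — smaller than every power of `e_k` — which pays `θ^{β′}` for the undecorated cubes of `X_β∖H_β`): the instance's `θ^{|H|}`
matches print's slot factors and `□_n`'s `θ^{β′}` is print's walk factor; `□_b`'s `θ^{β′}` is taken from clause (ii)'s located surplus (resp. from
the vacuum clause) instead of from the walk — a DECLARED BOOKKEEPING DIVERGENCE (the regime clause could be asked to pay both cubes,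
`4W³R³c₁²δ² ≤ m·θ^{2β′}`; the flip item carries (ii) in any case).

DIVERGENCE OF METHOD (declared): print bounds `g₃` by iterating `s`-derivatives, each producing functional derivatives of a `C²` observable and a
random-walk expansion of `C_s`; here ONE `s_n`-derivative is taken (`BIJ88ActInLastCubeSupp309`), it is CONDITIONED on the observable's cube
([Balaban1982Higgs2] (2.28); `BIJ88DexpCondMeanCov305`) so that only boundedness and measurability of the observable are used (the modulus slot
fields of this lineage are not `C²`), and the decay enters through the restricted covariance `(A_Λ)⁻¹ = C^{(0)}_Λ` of (2.29)
(`BIJ88DexpCondMeanMajorant305`, `BIJ88EndChainFluct309`); the row-sum form (a) of the decay input is DERIVED from (b)+W+R in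
`BIJ88EndChainFluct309.rowSum_boundary_le`.

(v1.2 DOC-ONLY: p. 309 quote corrected per referee D-g70-1 / owner D-owner-v2.293 — print p0053 L16 reads «e^β(L^kε/ε₀)^{1/4−α} in the final estimate»; v1.1: the owner's reading grid (r16 08:13Z/08:16Z) answered in the header — geometry clause sentence, θ-accounting table, print's count,
the class named; declarations byte-identical to v1 p358579.)

statement-level skeleton of published theorems with citation tags; proofs where landed; nothing here is a claim about the Yang–Mills mass gap

PDF held: `paper:balaban1988-cmp114-bij-abelian-higgs-effective-action` (journal page = PDF page + 256); p. 309 (p0053 L14–16: *"Let us drop the prime,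
and prove that |g₃(H_β, X_β)| ≦ (e^β(L^kε/ε₀)^{1/4−α})^{[|H_β| + β′|X_β∖H_β|]}. (5.14.4) … The proof of this estimate is similar to the one for g₂."*),
p. 307 (p0051) as quoted, p. 309 *"Each factor V^{(k)}(Y) in Π(d/dt)_{γ_j} produces a factor e^β(L^kε/ε₀)^{1/4−α} in the final estimate"* (clause (ii)); p. 305 (p0049
L17–18): *"Using the theorem on unit lattice operators in [6], we can invert this operator to yield an exponentially decaying covariance
C_s = (−Δ_s)⁻¹."* (the decay letter's printed source).

WHAT IS PROVED (unit `lit-balaban-p36`, generation 19 of the Phase-2 proof seat p36; SKELETON rows C2.Eq5.14.3-5.14.4 (flip item) / C2.Eq5.14.5 (C1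
xref) of `HOME/lit-balaban-r16/ROWS-C2-part2.md`, owner r16; 0 definitions, 0 `Prop` facts, theorems only).
* §1 the derivative observables of the chain: `fD_eq_one_of_free`, `exists_inr_of_mem_filter`, `measurable_fD_of_inr`, `abs_fD_le_of_inr` (`|fD_a| ≤ κ^{|H|}e^{GK₁}` when every
  `K_Y ≤ κ`), `abs_fD_empty_sub_one_le` (`|fD_a − 1| ≤ e^{GK₁} − 1` on the vacuum).
* §2 exponent bookkeeping `bookkeeping_nonempty`, `bookkeeping_empty`.
* §3 **`ineq5144_locAct_endChain_of_decay`** — the display (engine `BIJ88ActInFarCube309.abs_actIn_le_of_condMean_fluct` with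
  `BIJ88EndChainFluct309.fluct_le`).
HONEST SCOPE: ONE instance class (sourceless end-decorated three-cube chains), not the located `|X_β| ≥ 3` reading in general (middle-decorated
chains, χ-decorated cubes, sources `ℱ ≠ 0`, longer polymers are NOT covered); the decay letter is an INPUT on the restricted interpolated
precisions, not derived from a letter on `Δ`.  Imports `BIJ88EndChainFluct309` (p36 g19); modifies nothing; the head of record of row C2.Eq5.14.5
(`BIJ88Eq5145HeadThreeCubeChi`, p348629) is untouched.  NOT summit progress; NOT continuum; NOT Clay.  Cell `lit-balaban` Phase 2, seat p36 gen 19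
(owner r16, referee ref-5).
-/

noncomputable section

open Finset MeasureTheory Matrix Function Filter
open Literature.MathematicalPhysics.QuantumFieldTheory.Balaban1983to89
open Literature.MathematicalPhysics.QuantumFieldTheory.BalabanImbrieJaffe1984to88
open B2Eq228Conditioning (In Out resIn resOut glue blkIn blkMix condShift)
open BIJ88Sect5Statements (CutoffProfile)
open BIJ88SlotMoments308 (slotFactor slotFactor_inr)
open BIJ88RestrictedInteractionAllOrders308 (iteratedDeriv_expWeight)
open BIJ88OneCubeSlotEstimates309 (abs_iteratedDeriv_slotFactor_inr_le)
open BIJ88DirichletForms305 (interpForm interpForm_posDef quadForm_interpForm_ge)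
open BIJ88PolymerRep5134 (corner)
open BIJ88PolymerRep5134GaussWitness (corner_mem_cube)
open BIJ88Expansion5143Gauss (fD fD_local)
open BIJ88SlotMomentsGauss308 (uD)
open BIJ88SlotConnectedGraph310 (uD_local)
open BIJ88Eq5145CornerModel (slotB slotY)
open BIJ88Eq5145CornerUrsell (cubeIn)
open BIJ88W6PrimeVsupp (actIn)
open BIJ88W6PrimeVsuppBound (card_filter_cubeIn_le)
open BIJ88Ineq5144Located (locAct locAct_of_loc locAct_of_not_loc)
open BIJ88SecondOrder5133 (num Dfun)
open BIJ88ActInFarCube309 (abs_actIn_le_of_condMean_fluct)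
open BIJ88EndChainFluct309 (exists_quadForm_le fluct_le)

namespace Literature.MathematicalPhysics.QuantumFieldTheory.BalabanImbrieJaffe1984to88.BIJ88Ineq5144EndChainDecay

variable {α I : Type} [Fintype α] [DecidableEq α] [Fintype I] [DecidableEq I] (blk : α → I) (Δ : Matrix α α ℝ) (ℱ : α → ℝ)
variable (adj : I → I → Prop) [DecidableRel adj]
variable (χ : CutoffProfile) {ι υ : Type} [DecidableEq ι] [DecidableEq υ]
variable (p ek : ℝ) (B : Finset ι) (Φ : ι → (α → ℝ) → ℝ) (c : ι → ℝ) (Ys : Finset υ) (V : υ → (α → ℝ) → ℝ)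
variable (cube : ↥B ⊕ ↥Ys → I) (X : Finset I) (t : ℝ) {L : Type} [DecidableEq L] (γ : L → ↥(slotB B Ys cube X) ⊕ ↥(slotY B Ys cube X))

/-! ## §1 The derivative observables of the end-decorated chain -/

section Slots

omit [Fintype α] [DecidableEq α] [Fintype I] [DecidableEq L] in
/-- a slot-free cube carries the trivial derivative observable `fD = 1`. [cite: BalabanImbrieJaffe1988, (5.14.3) p.309] -/
theorem fD_eq_one_of_free {i : I} (hfree : ∀ τ : ↥B ⊕ ↥Ys, cube τ ≠ i) (K : Finset L) (φ : α → ℝ) :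
    fD (uD χ p ek (slotB B Ys cube X) (fun b : ↥B => Φ b) (fun b : ↥B => c b) (slotY B Ys cube X) (fun Y : ↥Ys => V Y) t)
      (cubeIn cube X) γ K i φ = 1 := by
  simp only [fD]
  exact prod_eq_one fun τ hτ => absurd (mem_filter.1 hτ).2 (by rcases τ with b' | Y; exacts [hfree _, hfree _])

omit [Fintype α] [DecidableEq α] [Fintype I] [DecidableEq ι] [DecidableEq υ] in
/-- the slots located at a cube free of χ-slots are interaction slots. [cite: BalabanImbrieJaffe1988, (5.14.2) p.308] -/
theorem exists_inr_of_mem_filter {i : I} (hiV : ∀ b' : ↥B, cube (Sum.inl b') ≠ i)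
    {τ : ↥(slotB B Ys cube X) ⊕ ↥(slotY B Ys cube X)} (hτ : τ ∈ univ.filter fun τ => cubeIn cube X τ = i) :
    ∃ Y : ↥(slotY B Ys cube X), τ = Sum.inr Y := by
  rcases τ with b' | Y
  · exact absurd (mem_filter.1 hτ).2 (hiV b'.1)
  · exact ⟨Y, rfl⟩

omit [Fintype α] [DecidableEq α] [Fintype I] [DecidableEq L] in
/-- the derivative observable of a cube decorated by interaction slots only is measurable in the field (`(d/dt)^m e^{−tV} = (−V)^m e^{−tV}`).
[cite: BalabanImbrieJaffe1988, (5.14.3) p.309] -/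
theorem measurable_fD_of_inr {i : I} (hiV : ∀ b' : ↥B, cube (Sum.inl b') ≠ i) (hV : ∀ Y ∈ Ys, Measurable (V Y)) (K : Finset L) :
    Measurable fun ψ : α → ℝ =>
      fD (uD χ p ek (slotB B Ys cube X) (fun b : ↥B => Φ b) (fun b : ↥B => c b) (slotY B Ys cube X) (fun Y : ↥Ys => V Y) t)
        (cubeIn cube X) γ K i ψ := by
  simp only [fD]
  refine Finset.measurable_prod _ fun τ hτ => ?_
  obtain ⟨Y, rfl⟩ := exists_inr_of_mem_filter B Ys cube X hiV hτ
  show Measurable fun ψ : α → ℝ =>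
    uD χ p ek (slotB B Ys cube X) (fun b : ↥B => Φ b) (fun b : ↥B => c b) (slotY B Ys cube X) (fun Y : ↥Ys => V Y) t (Sum.inr Y) _ ψ
  simp only [uD, slotFactor_inr, iteratedDeriv_expWeight]
  exact ((hV Y.1 Y.1.2).neg.pow_const _).mul (Real.measurable_exp.comp ((hV Y.1 Y.1.2).const_mul t).neg)

omit [Fintype α] [DecidableEq α] [Fintype I] [DecidableEq L] in
/-- **the decorated cube's observable under clause (ii)**: if every slot located at `□_i` is an interaction slot, `|V_Y| ≤ K_Y ≤ κ`, `K_Y ≤ K₁`,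
`≤ G` slots per cube, `0 ≤ t ≤ 1`, and every label of `K` is located at `□_i`, then `|fD_i(K)| ≤ κ^{|K|}·e^{GK₁}` (p. 309: *"Each factor V^{(k)}(Y)
in Π(d/dt)_{γ_j} produces a factor …"*: `|(d/dt)^m e^{−tV_Y}| ≤ K_Y^m e^{K_Y}`, and `Σ_τ m_τ = |K|`). [cite: BalabanImbrieJaffe1988, (5.14.4) p.309] -/
theorem abs_fD_le_of_inr [Fintype ι] [Fintype υ] {i : I} (hiV : ∀ b' : ↥B, cube (Sum.inl b') ≠ i)
    {KY : υ → ℝ} (hK : ∀ Y ∈ Ys, ∀ φ, |V Y φ| ≤ KY Y) {K₁ : ℝ} (hK₁0 : 0 ≤ K₁) (hK₁ : ∀ Y ∈ Ys, KY Y ≤ K₁)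
    {G : ℕ} (hG : ∀ i, (univ.filter fun τ : ↥B ⊕ ↥Ys => cube τ = i).card ≤ G) (ht0 : 0 ≤ t) (ht1 : t ≤ 1)
    {κ : ℝ} (hκ0 : 0 ≤ κ) (hκ : ∀ Y ∈ Ys, KY Y ≤ κ) (K : Finset L) (hKi : ∀ j ∈ K, cubeIn cube X (γ j) = i) (ψ : α → ℝ) :
    |fD (uD χ p ek (slotB B Ys cube X) (fun b : ↥B => Φ b) (fun b : ↥B => c b) (slotY B Ys cube X) (fun Y : ↥Ys => V Y) t)
        (cubeIn cube X) γ K i ψ| ≤ κ ^ K.card * Real.exp (G * K₁) := by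
  have hKY0 : ∀ Y ∈ Ys, 0 ≤ KY Y := fun Y hY => (abs_nonneg _).trans (hK Y hY 0)
  simp only [fD]
  rw [Finset.abs_prod]
  -- per slot: `|(d/dt)^m e^{−tV_Y}| ≤ K_Y^m e^{K_Y}`
  have hpt : ∀ τ ∈ (univ.filter fun τ : ↥(slotB B Ys cube X) ⊕ ↥(slotY B Ys cube X) => cubeIn cube X τ = i),
      |uD χ p ek (slotB B Ys cube X) (fun b : ↥B => Φ b) (fun b : ↥B => c b) (slotY B Ys cube X) (fun Y : ↥Ys => V Y) t τ
          (K.filter fun j => γ j = τ).card ψ|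
        ≤ (Sum.elim (fun _ => (0 : ℝ)) (fun Y : ↥(slotY B Ys cube X) => KY (Y.1 : υ)) τ) ^ (K.filter fun j => γ j = τ).card *
          Real.exp (Sum.elim (fun _ => (0 : ℝ)) (fun Y : ↥(slotY B Ys cube X) => KY (Y.1 : υ)) τ) := by
    intro τ hτ
    obtain ⟨Y, rfl⟩ := exists_inr_of_mem_filter B Ys cube X hiV hτ
    simp only [Sum.elim_inr, uD]
    exact abs_iteratedDeriv_slotFactor_inr_le χ p ek (slotB B Ys cube X) (fun b : ↥B => Φ b) (fun b : ↥B => c b)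
      (slotY B Ys cube X) (fun Y : ↥Ys => V Y) ht0 ht1 ψ Y (hK Y.1 Y.1.2 ψ) _
  refine (prod_le_prod (fun _ _ => abs_nonneg _) hpt).trans ?_
  rw [prod_mul_distrib, ← Real.exp_sum]
  -- `Σ_τ m_τ = |K|`, `K_Y ≤ κ`, `Σ_τ K_τ ≤ G K₁`
  have hcardK : K.card = ∑ τ ∈ (univ.filter fun τ : ↥(slotB B Ys cube X) ⊕ ↥(slotY B Ys cube X) => cubeIn cube X τ = i),
      (K.filter fun j => γ j = τ).card :=
    card_eq_sum_card_fiberwise fun j hj => mem_filter.2 ⟨mem_univ _, hKi j hj⟩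
  have h1 : ∏ τ ∈ (univ.filter fun τ : ↥(slotB B Ys cube X) ⊕ ↥(slotY B Ys cube X) => cubeIn cube X τ = i),
      (Sum.elim (fun _ => (0 : ℝ)) (fun Y : ↥(slotY B Ys cube X) => KY (Y.1 : υ)) τ) ^ (K.filter fun j => γ j = τ).card
        ≤ κ ^ K.card := by
    rw [hcardK, ← prod_pow_eq_pow_sum]
    refine prod_le_prod (fun τ hτ => ?_) fun τ hτ => ?_
    · obtain ⟨Y, rfl⟩ := exists_inr_of_mem_filter B Ys cube X hiV hτ
      simp only [Sum.elim_inr]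
      exact pow_nonneg (hKY0 Y.1 Y.1.2) _
    · obtain ⟨Y, rfl⟩ := exists_inr_of_mem_filter B Ys cube X hiV hτ
      simp only [Sum.elim_inr]
      exact pow_le_pow_left₀ (hKY0 Y.1 Y.1.2) (hκ Y.1 Y.1.2) _
  have h2 : ∑ τ ∈ (univ.filter fun τ : ↥(slotB B Ys cube X) ⊕ ↥(slotY B Ys cube X) => cubeIn cube X τ = i),
      Sum.elim (fun _ => (0 : ℝ)) (fun Y : ↥(slotY B Ys cube X) => KY (Y.1 : υ)) τ ≤ G * K₁ := by
    calc _ ≤ ∑ τ ∈ (univ.filter fun τ : ↥(slotB B Ys cube X) ⊕ ↥(slotY B Ys cube X) => cubeIn cube X τ = i), K₁ :=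
          sum_le_sum fun τ hτ => by
            obtain ⟨Y, rfl⟩ := exists_inr_of_mem_filter B Ys cube X hiV hτ
            simp only [Sum.elim_inr]
            exact hK₁ Y.1 Y.1.2
      _ = ((univ.filter fun τ : ↥(slotB B Ys cube X) ⊕ ↥(slotY B Ys cube X) => cubeIn cube X τ = i).card : ℝ) * K₁ := by
          rw [sum_const, nsmul_eq_mul]
      _ ≤ G * K₁ := mul_le_mul_of_nonneg_right (by exact_mod_cast (card_filter_cubeIn_le (cube := cube) X i).trans (hG i)) hK₁0
  exact mul_le_mul h1 (Real.exp_le_exp.2 h2) (Real.exp_pos _).le (pow_nonneg hκ0 _)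

omit [Fintype α] [DecidableEq α] [Fintype I] [DecidableEq L] in
/-- **the decorated cube's observable on the vacuum polymer**: with no derivative, `fD_i(∅) = Π_Y e^{−tV_Y}` and `|fD_i(∅) − 1| ≤ e^{GK₁} − 1`.
[cite: BalabanImbrieJaffe1988, (5.14.4) p.309; p.309 (g₃ = 1 + g₃′)] -/
theorem abs_fD_empty_sub_one_le [Fintype ι] [Fintype υ] {i : I} (hiV : ∀ b' : ↥B, cube (Sum.inl b') ≠ i)
    {KY : υ → ℝ} (hK : ∀ Y ∈ Ys, ∀ φ, |V Y φ| ≤ KY Y) {K₁ : ℝ} (hK₁0 : 0 ≤ K₁) (hK₁ : ∀ Y ∈ Ys, KY Y ≤ K₁)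
    {G : ℕ} (hG : ∀ i, (univ.filter fun τ : ↥B ⊕ ↥Ys => cube τ = i).card ≤ G) (ht0 : 0 ≤ t) (ht1 : t ≤ 1) (ψ : α → ℝ) :
    |fD (uD χ p ek (slotB B Ys cube X) (fun b : ↥B => Φ b) (fun b : ↥B => c b) (slotY B Ys cube X) (fun Y : ↥Ys => V Y) t)
        (cubeIn cube X) γ ∅ i ψ - 1| ≤ Real.exp (G * K₁) - 1 := by
  simp only [fD, Finset.filter_empty, Finset.card_empty]
  have heq : ∏ τ ∈ (univ.filter fun τ : ↥(slotB B Ys cube X) ⊕ ↥(slotY B Ys cube X) => cubeIn cube X τ = i),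
      uD χ p ek (slotB B Ys cube X) (fun b : ↥B => Φ b) (fun b : ↥B => c b) (slotY B Ys cube X) (fun Y : ↥Ys => V Y) t τ 0 ψ =
      Real.exp (∑ τ ∈ (univ.filter fun τ : ↥(slotB B Ys cube X) ⊕ ↥(slotY B Ys cube X) => cubeIn cube X τ = i),
        Sum.elim (fun _ => (0 : ℝ)) (fun Y : ↥(slotY B Ys cube X) => -(t * V (Y.1 : υ) ψ)) τ) := by
    rw [Real.exp_sum]
    refine prod_congr rfl fun τ hτ => ?_
    obtain ⟨Y, rfl⟩ := exists_inr_of_mem_filter B Ys cube X hiV hτ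
    simp only [uD, iteratedDeriv_zero, slotFactor_inr, Sum.elim_inr]
  rw [heq]
  have hsum : |∑ τ ∈ (univ.filter fun τ : ↥(slotB B Ys cube X) ⊕ ↥(slotY B Ys cube X) => cubeIn cube X τ = i),
      Sum.elim (fun _ => (0 : ℝ)) (fun Y : ↥(slotY B Ys cube X) => -(t * V (Y.1 : υ) ψ)) τ| ≤ G * K₁ := by
    refine (abs_sum_le_sum_abs _ _).trans ?_
    calc _ ≤ ∑ τ ∈ (univ.filter fun τ : ↥(slotB B Ys cube X) ⊕ ↥(slotY B Ys cube X) => cubeIn cube X τ = i), K₁ :=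
          sum_le_sum fun τ hτ => by
            obtain ⟨Y, rfl⟩ := exists_inr_of_mem_filter B Ys cube X hiV hτ
            simp only [Sum.elim_inr, abs_neg, abs_mul, abs_of_nonneg ht0]
            exact (mul_le_of_le_one_left (abs_nonneg _) ht1).trans ((hK Y.1 Y.1.2 ψ).trans (hK₁ Y.1 Y.1.2))
      _ = ((univ.filter fun τ : ↥(slotB B Ys cube X) ⊕ ↥(slotY B Ys cube X) => cubeIn cube X τ = i).card : ℝ) * K₁ := by
          rw [sum_const, nsmul_eq_mul]
      _ ≤ G * K₁ := mul_le_mul_of_nonneg_right (by exact_mod_cast (card_filter_cubeIn_le (cube := cube) X i).trans (hG i)) hK₁0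
  -- `|eˣ − 1| ≤ e^{|x|} − 1` (`2 ≤ eˣ + e^{−x}`; the tree's copy lives in an unrelated module, restated inline)
  have hexp1 : ∀ x : ℝ, |Real.exp x - 1| ≤ Real.exp |x| - 1 := fun x => by
    rcases le_or_gt 0 x with hx | hx
    · rw [abs_of_nonneg hx, abs_of_nonneg (by linarith [Real.one_le_exp hx] : 0 ≤ Real.exp x - 1)]
    · rw [abs_of_neg hx, abs_of_neg (by linarith [Real.exp_lt_one_iff.mpr hx] : Real.exp x - 1 < 0)]
      linarith [Real.add_one_le_exp x, Real.add_one_le_exp (-x)]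
  exact (hexp1 _).trans (sub_le_sub_right (Real.exp_le_exp.2 hsum) 1)

end Slots

/-! ## §2 Exponent bookkeeping -/

/-- vacuum polymer: `4·(2·(θ^{2β′}/2)·M) ≤ θ^{3β′}` when `4M ≤ θ^{β′}`. [cite: BalabanImbrieJaffe1988, (5.14.4) p.309] -/
theorem bookkeeping_empty {θ β' M : ℝ} (hθ0 : 0 < θ) (h4 : 4 * M ≤ θ ^ β') :
    (2 : ℝ) ^ (3 - 1) * (2 * (θ ^ (2 * β') / 2) * M) ≤ θ ^ ((0 : ℝ) + β' * 3) := by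
  rw [zero_add, show β' * 3 = 2 * β' + β' by ring, Real.rpow_add hθ0]
  have h0 : 0 ≤ θ ^ (2 * β') := Real.rpow_nonneg hθ0.le _
  calc (2 : ℝ) ^ (3 - 1) * (2 * (θ ^ (2 * β') / 2) * M) = θ ^ (2 * β') * (4 * M) := by norm_num; ring
    _ ≤ θ ^ (2 * β') * θ ^ β' := mul_le_mul_of_nonneg_left h4 h0

/-- decorated polymer: `4·(2·(θ^{1+β′}/2)^k·M) ≤ θ^{k + 2β′}` when `k ≥ 1`, `4M ≤ θ^{β′}`, `0 < θ ≤ 1`, `0 ≤ β′` (the clause's own `θ^{β′}` and the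
fluctuation's `θ^{β′}` pay the two undecorated cubes). [cite: BalabanImbrieJaffe1988, (5.14.4) p.309] -/
theorem bookkeeping_nonempty {θ β' M : ℝ} (hθ0 : 0 < θ) (hθ1 : θ ≤ 1) (hβ : 0 ≤ β') {k : ℕ} (hk : 1 ≤ k) (hM0 : 0 ≤ M)
    (h4 : 4 * M ≤ θ ^ β') : (2 : ℝ) ^ (3 - 1) * (2 * (θ ^ (1 + β') / 2) ^ k * M) ≤ θ ^ ((k : ℝ) + β' * 2) := by
  have hθp : 0 < θ ^ (1 + β') := Real.rpow_pos_of_pos hθ0 _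
  have h2k : (2 : ℝ) ≤ 2 ^ k := by
    calc (2 : ℝ) = 2 ^ 1 := (pow_one _).symm
      _ ≤ 2 ^ k := pow_le_pow_right₀ (by norm_num) hk
  have hhalf : (θ ^ (1 + β') / 2) ^ k ≤ (θ ^ (1 + β')) ^ k / 2 := by
    rw [div_pow]; exact div_le_div_of_nonneg_left (pow_nonneg hθp.le _) (by norm_num) h2k
  have hstep : (θ ^ (1 + β')) ^ k = θ ^ ((1 + β') * k) := by rw [← Real.rpow_natCast, ← Real.rpow_mul hθ0.le]
  have hk' : (1 : ℝ) ≤ k := by exact_mod_cast hk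
  have hexp : θ ^ ((1 + β') * k) * θ ^ β' ≤ θ ^ ((k : ℝ) + β' * 2) := by
    rw [← Real.rpow_add hθ0]
    exact Real.rpow_le_rpow_of_exponent_ge hθ0 hθ1 (by nlinarith)
  calc (2 : ℝ) ^ (3 - 1) * (2 * (θ ^ (1 + β') / 2) ^ k * M) = 2 * (θ ^ (1 + β') / 2) ^ k * (4 * M) := by norm_num; ring
    _ ≤ 2 * ((θ ^ (1 + β')) ^ k / 2) * θ ^ β' :=
        mul_le_mul (mul_le_mul_of_nonneg_left hhalf (by norm_num)) h4 (by linarith)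
          (mul_nonneg (by norm_num) (div_nonneg (pow_nonneg hθp.le _) (by norm_num)))
    _ = θ ^ ((1 + β') * k) * θ ^ β' := by rw [hstep]; ring
    _ ≤ _ := hexp

/-! ## §3 (5.14.4), located, on the end-decorated three-cube chain -/

section Main

/-- **(5.14.4) LOCATED ON THE END-DECORATED THREE-CUBE CHAIN WITH THE DECAY LETTER (i) AND THE V-SURPLUS CLAUSE (ii)** — see the module
docstring for the class, the letters and the divergence of method.  `□_n` is the far end of the chain `a – b – n`; the conditioning set is
`Λ = {x | □x ≠ a}`, the sites off the observable's cube; `H ⊆ L` the labels carrying `(d/dt)`, `γ` the assignment of labels to the slots located in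
the region `X`, `Λ′` the corner of the precision.  Proof: off the located pairs the activity is `0`; on them every label sits at `□_a`, the
observable is `Π_{□_i⊂X₃} fD_i = fD_a` (slot-free `□_b`, `□_n`), the engine `abs_actIn_le_of_condMean_fluct` gives `|g₃| ≤ 4·2K₀·M` with
`M = W·R·(Wc₁δR)²/m ≤ θ^{β′}/4` (`BIJ88EndChainFluct309.fluct_le`, the regime clause) and `K₀ = (θ^{1+β′}/2)^{|H|}` (clause (ii)) resp. `θ^{2β′}/2`
(vacuum), and the exponents are collected against `|X₃ ∖ □(γ(H))| = 2` resp. `3`. [cite: BalabanImbrieJaffe1988, (5.14.4) p.309; p.307 (Sect. 5.13)] -/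
theorem ineq5144_locAct_endChain_of_decay [Fintype ι] [Fintype υ]
    (hΔ : Δ.PosDef) {m : ℝ} (hm : 0 < m) (hΔm : ∀ φ : α → ℝ, m * (φ ⬝ᵥ φ) ≤ φ ⬝ᵥ (Δ *ᵥ φ))
    (hΦloc : ∀ b : B, ∀ φ ψ : α → ℝ, (∀ x, blk x = cube (Sum.inl b) → φ x = ψ x) → Φ b φ = Φ b ψ)
    (hVloc : ∀ Y : Ys, ∀ φ ψ : α → ℝ, (∀ x, blk x = cube (Sum.inr Y) → φ x = ψ x) → V Y φ = V Y ψ)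
    (hV : ∀ Y ∈ Ys, Measurable (V Y)) {KY : υ → ℝ} (hK : ∀ Y ∈ Ys, ∀ φ, |V Y φ| ≤ KY Y)
    {K₁ : ℝ} (hK₁0 : 0 ≤ K₁) (hK₁ : ∀ Y ∈ Ys, KY Y ≤ K₁) {G : ℕ} (hG : ∀ i, (univ.filter fun τ : ↥B ⊕ ↥Ys => cube τ = i).card ≤ G)
    {θ β' : ℝ} (hθ0 : 0 < θ) (hθ1 : θ ≤ 1) (hβ : 0 ≤ β')
    (hvac : Real.exp (2 * G * K₁) - 1 ≤ θ ^ (2 * β') / 2) (hKθ₂ : ∀ Y ∈ Ys, KY Y * Real.exp (2 * G * K₁) ≤ θ ^ (1 + β') / 2)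
    -- the geometry letters W (sites per cube) and R (off-diagonal row sums of `Δ`)
    {W : ℕ} (hW : ∀ i, (univ.filter fun x : α => blk x = i).card ≤ W)
    {R : ℝ} (hR0 : 0 ≤ R) (hR : ∀ x, ∑ y ∈ univ.filter (fun y => blk y ≠ blk x), |Δ x y| ≤ R)
    -- the class: the sourceless end-decorated chain `a – b – n`
    (hℱ : ℱ = 0) {a b n : I} (hab : a ≠ b) (han : a ≠ n) (hbn : b ≠ n) (haV : ∀ b' : ↥B, cube (Sum.inl b') ≠ a)
    (hbfree : ∀ τ : ↥B ⊕ ↥Ys, cube τ ≠ b) (hnfree : ∀ τ : ↥B ⊕ ↥Ys, cube τ ≠ n) (hfar : ∀ x y, blk x = n → blk y = a → Δ x y = 0)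
    -- the decay letter (b) for the restricted interpolated precisions, the chain geometry, the regime clause
    (ds : α → α → ℕ) {c₁ δ : ℝ} (hc₁ : 0 ≤ c₁) (hδ0 : 0 ≤ δ) (hδ1 : δ ≤ 1)
    (hgeo : ∀ x l, (blk x = n ∨ (blk x = b ∧ ∃ y, blk y = n ∧ Δ y x ≠ 0)) → blk l = b → (∃ k, blk k = a ∧ Δ l k ≠ 0) → 1 ≤ ds x l)
    (Λc X : Finset I)
    (hdec : ∀ s : I → ℝ, (∀ l, 0 ≤ s l ∧ s l ≤ 1) → (∀ l, l ∉ ({a, b, n} : Finset I) → s l = 0) →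
      ∀ x l : In (fun x => blk x ≠ a),
        |(blkIn (fun x => blk x ≠ a) (interpForm blk (interpForm blk Δ (corner ℝ Λc)) s))⁻¹ x l| ≤ c₁ * δ ^ ds x.1 l.1)
    (hδθ : 4 * ((W : ℝ) ^ 3 * R ^ 3 * c₁ ^ 2 * δ ^ 2) ≤ m * θ ^ β')
    {t : ℝ} (ht0 : 0 ≤ t) (ht1 : t ≤ 1) {L : Type} [DecidableEq L] (γ : L → ↥(slotB B Ys cube X) ⊕ ↥(slotY B Ys cube X)) (H : Finset L) :
    |locAct (cubeIn cube X ∘ γ) (actIn blk Δ ℱ adj χ p ek B Φ c Ys V cube Λc X t γ) H ({a, b, n} : Finset I)| ≤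
      θ ^ ((H.card : ℝ) + β' * ((({a, b, n} : Finset I) \ H.image (cubeIn cube X ∘ γ)).card : ℝ)) := by
  subst hℱ
  -- off the located pairs the activity vanishes
  by_cases hloc : ∀ j ∈ H, (cubeIn cube X ∘ γ) j ∈ ({a, b, n} : Finset I)
  swap
  · rw [locAct_of_not_loc hloc, abs_zero]
    exact Real.rpow_nonneg hθ0.le _
  rw [locAct_of_loc hloc]
  -- the chain
  have hX3 : ({a, b, n} : Finset I).card = 3 := by
    rw [card_insert_of_notMem (by simp only [mem_insert, mem_singleton, not_or]; exact ⟨hab, han⟩), card_pair hbn]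
  have h2 : 2 ≤ ({a, b, n} : Finset I).card := by rw [hX3]; norm_num
  have hnX : n ∈ ({a, b, n} : Finset I) := by simp only [mem_insert, mem_singleton, or_true]
  -- every slot located in the chain sits at `□_a`
  have hslot : ∀ τ : ↥(slotB B Ys cube X) ⊕ ↥(slotY B Ys cube X), cubeIn cube X τ ∈ ({a, b, n} : Finset I) → cubeIn cube X τ = a := by
    intro τ hτ
    simp only [mem_insert, mem_singleton] at hτ
    rcases hτ with h | h | h
    · exact h
    · exact absurd h (by rcases τ with b' | Y; exacts [hbfree _, hbfree _])
    · exact absurd h (by rcases τ with b' | Y; exacts [hnfree _, hnfree _])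
  have hHa : ∀ j ∈ H, cubeIn cube X (γ j) = a := fun j hj => hslot _ (hloc j hj)
  -- the observable of the chain is the decorated cube's
  have hprod : ∀ ψ : α → ℝ, ∏ i ∈ ({a, b, n} : Finset I),
      fD (uD χ p ek (slotB B Ys cube X) (fun b : ↥B => Φ b) (fun b : ↥B => c b) (slotY B Ys cube X) (fun Y : ↥Ys => V Y) t)
        (cubeIn cube X) γ H i ψ =
      fD (uD χ p ek (slotB B Ys cube X) (fun b : ↥B => Φ b) (fun b : ↥B => c b) (slotY B Ys cube X) (fun Y : ↥Ys => V Y) t)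
        (cubeIn cube X) γ H a ψ := by
    intro ψ
    rw [prod_insert (by simp only [mem_insert, mem_singleton, not_or]; exact ⟨hab, han⟩), prod_pair hbn,
      fD_eq_one_of_free χ p ek B Φ c Ys V cube X t γ hbfree H ψ, fD_eq_one_of_free χ p ek B Φ c Ys V cube X t γ hnfree H ψ,
      mul_one, mul_one]
  -- the engine's hypotheses
  have hcs := corner_mem_cube (I := I) Λc
  have hΔc : (interpForm blk Δ (corner ℝ Λc)).PosDef := interpForm_posDef blk hΔ hcs
  have hmΔc : ∀ φ : α → ℝ, m * (φ ⬝ᵥ φ) ≤ φ ⬝ᵥ (interpForm blk Δ (corner ℝ Λc) *ᵥ φ) := quadForm_interpForm_ge blk hΔm hcs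
  obtain ⟨Cu, hCu⟩ := exists_quadForm_le (interpForm blk Δ (corner ℝ Λc))
  have hf : ∀ i (φ ψ : α → ℝ), (∀ x, blk x = i → φ x = ψ x) →
      fD (uD χ p ek (slotB B Ys cube X) (fun b : ↥B => Φ b) (fun b : ↥B => c b) (slotY B Ys cube X) (fun Y : ↥Ys => V Y) t)
        (cubeIn cube X) γ H i φ =
      fD (uD χ p ek (slotB B Ys cube X) (fun b : ↥B => Φ b) (fun b : ↥B => c b) (slotY B Ys cube X) (fun Y : ↥Ys => V Y) t)
        (cubeIn cube X) γ H i ψ := fun i φ ψ h =>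
    fD_local blk γ (uD_local blk χ (cubeIn cube X) (fun b' φ ψ h => hΦloc b'.1 φ ψ h) (fun Y φ ψ h => hVloc Y.1 φ ψ h) t) H i φ ψ h
  have hfm : Measurable fun ψ : α → ℝ => ∏ i ∈ ({a, b, n} : Finset I),
      fD (uD χ p ek (slotB B Ys cube X) (fun b : ↥B => Φ b) (fun b : ↥B => c b) (slotY B Ys cube X) (fun Y : ↥Ys => V Y) t)
        (cubeIn cube X) γ H i ψ := by
    rw [show (fun ψ : α → ℝ => ∏ i ∈ ({a, b, n} : Finset I),
        fD (uD χ p ek (slotB B Ys cube X) (fun b : ↥B => Φ b) (fun b : ↥B => c b) (slotY B Ys cube X) (fun Y : ↥Ys => V Y) t)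
          (cubeIn cube X) γ H i ψ) = fun ψ =>
        fD (uD χ p ek (slotB B Ys cube X) (fun b : ↥B => Φ b) (fun b : ↥B => c b) (slotY B Ys cube X) (fun Y : ↥Ys => V Y) t)
          (cubeIn cube X) γ H a ψ from funext hprod]
    exact measurable_fD_of_inr χ p ek B Φ c Ys V cube X t γ haV hV H
  have hlocP : ∀ φ ψ : α → ℝ, (∀ x, ¬ (fun x => blk x ≠ a) x → φ x = ψ x) →
      (∏ i ∈ ({a, b, n} : Finset I),
        fD (uD χ p ek (slotB B Ys cube X) (fun b : ↥B => Φ b) (fun b : ↥B => c b) (slotY B Ys cube X) (fun Y : ↥Ys => V Y) t)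
          (cubeIn cube X) γ H i φ) =
      ∏ i ∈ ({a, b, n} : Finset I),
        fD (uD χ p ek (slotB B Ys cube X) (fun b : ↥B => Φ b) (fun b : ↥B => c b) (slotY B Ys cube X) (fun Y : ↥Ys => V Y) t)
          (cubeIn cube X) γ H i ψ := fun φ ψ h => by
    rw [hprod, hprod]
    exact hf a φ ψ fun x hx => h x (not_ne_iff.2 hx)
  have hPn : ∀ x, blk x = n → (fun x => blk x ≠ a) x := fun x hx h => han (h.symm.trans hx)
  have hfar' : ∀ x y, blk x = n → ¬ (fun x => blk x ≠ a) y → Δ x y = 0 := fun x y hx hy => hfar x y hx (not_ne_iff.1 hy)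
  -- the fluctuation bound and the regime clause
  have hM0 : 0 ≤ W * R * ((W * (c₁ * δ * R)) ^ 2 * m⁻¹) :=
    mul_nonneg (mul_nonneg (Nat.cast_nonneg _) hR0) (mul_nonneg (sq_nonneg _) (inv_nonneg.2 hm.le))
  have h4M : 4 * (W * R * ((W * (c₁ * δ * R)) ^ 2 * m⁻¹)) ≤ θ ^ β' := by
    rw [show 4 * (W * R * ((W * (c₁ * δ * R)) ^ 2 * m⁻¹)) = 4 * ((W : ℝ) ^ 3 * R ^ 3 * c₁ ^ 2 * δ ^ 2) * m⁻¹ by ring,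
      mul_inv_le_iff₀ hm, mul_comm (θ ^ β') m]
    exact hδθ
  have hexpG : Real.exp (G * K₁) ≤ Real.exp (2 * G * K₁) :=
    Real.exp_le_exp.2 (by nlinarith [mul_nonneg (Nat.cast_nonneg G) hK₁0])
  rcases H.eq_empty_or_nonempty with rfl | hHne
  · -- the vacuum polymer: `c₀ = 1`, `K₀ = θ^{2β′}/2`
    have hK0 : ∀ ψ : α → ℝ, |(∏ i ∈ ({a, b, n} : Finset I),
        fD (uD χ p ek (slotB B Ys cube X) (fun b : ↥B => Φ b) (fun b : ↥B => c b) (slotY B Ys cube X) (fun Y : ↥Ys => V Y) t)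
          (cubeIn cube X) γ ∅ i ψ) - 1| ≤ θ ^ (2 * β') / 2 := fun ψ => by
      rw [hprod]
      refine (abs_fD_empty_sub_one_le χ p ek B Φ c Ys V cube X t γ haV hK hK₁0 hK₁ hG ht0 ht1 ψ).trans ?_
      linarith
    have hb := abs_actIn_le_of_condMean_fluct blk Δ 0 adj χ p ek B Φ c Ys V cube Λc X t γ ∅ h2 hΔc hm hmΔc hCu hf hfm 1 hK0
      (fun x => blk x ≠ a) hlocP hnX hPn hfar'
      (fun s hs hs0 => fluct_le blk hΔ hm hΔm hab han hfar hW hR0 hR ds hc₁ hδ0 hδ1 hgeo Λc hs hs0 (hdec s hs hs0))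
    refine hb.trans ?_
    rw [hX3, card_empty, image_empty, sdiff_empty, hX3]
    push_cast
    exact bookkeeping_empty hθ0 h4M
  · -- the decorated polymers: `c₀ = 0`, `K₀ = (θ^{1+β′}/2)^{|H|}`
    have hk : 1 ≤ H.card := by have := card_pos.2 hHne; omega
    have hκ : ∀ Y ∈ Ys, KY Y ≤ θ ^ (1 + β') / 2 / Real.exp (2 * G * K₁) := fun Y hY =>
      (le_div_iff₀ (Real.exp_pos _)).2 (hKθ₂ Y hY)
    have hθp : 0 ≤ θ ^ (1 + β') / 2 := div_nonneg (Real.rpow_nonneg hθ0.le _) (by norm_num)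
    have hκ0 : 0 ≤ θ ^ (1 + β') / 2 / Real.exp (2 * G * K₁) := div_nonneg hθp (Real.exp_pos _).le
    have hE1 : 1 ≤ Real.exp (2 * G * K₁) :=
      Real.one_le_exp (mul_nonneg (mul_nonneg (by norm_num) (Nat.cast_nonneg _)) hK₁0)
    have hK0 : ∀ ψ : α → ℝ, |(∏ i ∈ ({a, b, n} : Finset I),
        fD (uD χ p ek (slotB B Ys cube X) (fun b : ↥B => Φ b) (fun b : ↥B => c b) (slotY B Ys cube X) (fun Y : ↥Ys => V Y) t)
          (cubeIn cube X) γ H i ψ) - 0| ≤ (θ ^ (1 + β') / 2) ^ H.card := fun ψ => by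
      rw [sub_zero, hprod]
      refine (abs_fD_le_of_inr χ p ek B Φ c Ys V cube X t γ haV hK hK₁0 hK₁ hG ht0 ht1 hκ0 hκ H hHa ψ).trans ?_
      rw [div_pow, div_mul_eq_mul_div, div_le_iff₀ (pow_pos (Real.exp_pos _) _)]
      exact mul_le_mul_of_nonneg_left (hexpG.trans (le_self_pow₀ hE1 (by omega))) (pow_nonneg hθp _)
    have hb := abs_actIn_le_of_condMean_fluct blk Δ 0 adj χ p ek B Φ c Ys V cube Λc X t γ H h2 hΔc hm hmΔc hCu hf hfm 0 hK0
      (fun x => blk x ≠ a) hlocP hnX hPn hfar'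
      (fun s hs hs0 => fluct_le blk hΔ hm hΔm hab han hfar hW hR0 hR ds hc₁ hδ0 hδ1 hgeo Λc hs hs0 (hdec s hs hs0))
    refine hb.trans ?_
    -- `a ∈ □(γ(H))`, so at most two undecorated cubes
    have hcard : ((({a, b, n} : Finset I) \ H.image (cubeIn cube X ∘ γ)).card : ℝ) ≤ 2 := by
      obtain ⟨j, hj⟩ := hHne
      have ha : a ∈ H.image (cubeIn cube X ∘ γ) := mem_image.2 ⟨j, hj, hHa j hj⟩
      have hsub : ({a, b, n} : Finset I) \ H.image (cubeIn cube X ∘ γ) ⊆ ({a, b, n} : Finset I).erase a := by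
        intro i hi
        rw [Finset.mem_sdiff] at hi
        exact mem_erase.2 ⟨fun h => hi.2 (h ▸ ha), hi.1⟩
      have h := (card_le_card hsub).trans (le_of_eq (by rw [card_erase_of_mem (by simp only [mem_insert, true_or]), hX3]))
      exact_mod_cast h
    calc _ ≤ θ ^ ((H.card : ℝ) + β' * 2) := by rw [hX3]; exact bookkeeping_nonempty hθ0 hθ1 hβ hk hM0 h4M
      _ ≤ _ := Real.rpow_le_rpow_of_exponent_ge hθ0 hθ1 (by nlinarith [hcard, hβ])

end Main

end Literature.MathematicalPhysics.QuantumFieldTheory.BalabanImbrieJaffe1984to88.BIJ88Ineq5144EndChainDecay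

end
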